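import Mathlib
import HarnessLib
import Summits.MatrixMultiplication.Statement
import Summits.MatrixMultiplication.MatrixMultiplication.Theses.FarEdgeDescent
import Summits.MatrixMultiplication.MatrixMultiplication.Theorems.FarEdgeDescentHostProfile
import Literature.Computability.AlgebraicComplexity.SchonhageRectangular
import Literature.Barriers.MatrixMultiplication.RectangularBarrierSoundness

/-!
# FarEdgeDescent — Kernel XLIX-B (lens-2 «structural dichotomy», gen 64): the host bridge to
`FiniteSaturation`, its EQUIV boundary, and the route-level dichotomy

Helper file for the crux `FiniteSaturation` (stmt-MatrixMultiplication-23739,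
`∃ k ≥ 2, ω(1,k,1) = k + 1`) of `route-MatrixMultiplication-FarEdgeDescent`; closes no item,
introduces no definition. The route-independent analysis of hosts (bound, profile, dichotomy) is
`FarEdgeDescentHostProfile`; here it is turned into statements about the crux.

* §1 BRIDGE. `finiteSaturation_of_host`: `k ≥ 2 ∧ Host_k(t, r) ⟹ FiniteSaturation`, where
  `Host_k(t, r)` is the inline hypothesis "`R̃(t) ≤ r` and for every `ε > 0` some power
  `t^{⊠(N+1)}` degenerates to some `⟨m, m^k, m⟩`, `m ≥ 2`, with `r^{N+1} ≤ m^{(k+1)(1+ε)}`";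
  `finiteSaturation_of_borderHost` (proxy = ONE border-rank identity `R̲(t) ≤ b`, BCS (15.27));
  `finiteSaturation_of_tMethodBound`: a CLLZ asymptotic `T`-method bound
  `IsTMethodBound ℂ T k (k+1)` gives `FiniteSaturation` through the tree's PROVED soundness
  `CLLZ2025_tMethodBound_sound_holds`.
* §2 EQUIV BOUNDARY (tag COSTUME for the unrestricted proxy). `⟨2, 2^k, 2⟩` is its own host with
  proxy `R̃(⟨2,2^k,2⟩)` as soon as `e(k) = 0` (`matMulTensor_selfHost_of_saturated`), whence
  `finiteSaturation_iff_selfHost`: "some `R̃`-certified host exists" RESTATES the crux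
  (dictionary `finiteSaturation_iff_asymptoticRank_two`). The content of the host object is
  therefore entirely in HOW `R̃(t) ≤ r` is certified.
* §3 ROUTE-LEVEL DICHOTOMY (`host_dichotomy`, exhaustive because `R̃ ≤ R̲`): a host of a finite
  saturation is EITHER border-flat — `R̲(t) = R̃(t) = r ≤ min(|κ|, |μ|)`, a tensor of minimal border
  rank whose powers reach the far edge at full value (special branch: ONE finite identity plus
  extraction; UNDECIDED, sufficient, not known necessary) — OR strictly flat, `R̃(t) = r < R̲(t)`,
  certified only by an asymptotic-rank theorem strictly below border rank (generic branch; contains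
  the route's aside `LittleCwFlat`, since `R̲(cw_q) = q + 2 > q + 1`, `cwTensor_not_borderHost`).
  The lineage's `β = 2` degenerate endpoint (Kernels XLIII–XLVIII) says the KNOWN border-flat hosts
  (Schönhage pairs, `CW_q`) fail the off-face profile `F^θ(t) ≥ r^{1−(k−1)θ₀/(k+1)}`
  (`rpow_le_quantumFunctional_of_host'`; CLLZ Table 1, `ω̂_{CW_q}(2) ≥ 3.06`): the special branch
  needs a NEW minimal-border-rank host, screened by that profile.

Barriers: `Literature.Barriers.MatrixMultiplication.RectangularBarrier` — the profile IS the barrier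
inequality at `(p, ω̂) = (k, k+1)`, a design specification, not evaded; `UnstableTensorBarrier`
(Bläser–Lysikov Thm. 16) bars `ω = 2` from minimal-border-rank binding tensors, not a finite
saturation. Negatives index of the summit (12 refuted statements): none concerns hosts.

[cite: ChristandlLeGallLysikovZuiddam2025, Thm. 2.1, Rem. 3.13 and Thm. 3.15]
[cite: BurgisserClausenShokrollahi1997, Lemma (15.27)]
[cite: AlmanDuanVassilevskaWilliamsXuXuZhou2025, §3.4]
-/

namespace Summit.MatrixMultiplication.MatrixMultiplication.Theorems.FarEdgeDescentHostBridge

open Literature.Computability.AlgebraicComplexity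
open Literature.Barriers.MatrixMultiplication
open Summit.MatrixMultiplication.MatrixMultiplication.Theses.FarEdgeDescent
open Summit.MatrixMultiplication.MatrixMultiplication.Theorems.FarEdgeDescentHostProfile

section Host

variable {ι κ μ : Type} [Fintype ι] [Fintype κ] [Fintype μ] {t : ι → κ → μ → ℂ} {r : ℝ} {k : ℕ}

/-! ## §1 The bridge -/

/-- **`k ≥ 2 ∧ Host_k(t, r) ⟹ FiniteSaturation`** (`omegaRect_eq_of_host`).
[cite: ChristandlLeGallLysikovZuiddam2025, Thm. 2.1] -/
theorem finiteSaturation_of_host (hk : 2 ≤ k) (hr : asymptoticRank t ≤ r)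
    (hhost : ∀ ε : ℝ, 0 < ε → ∃ N m : ℕ, 2 ≤ m ∧
      AlgDegeneratesTo (kroneckerPow t (N + 1)) (matMulTensor ℂ m (m ^ k) m) ∧
      r ^ (N + 1) ≤ (m : ℝ) ^ (((k : ℝ) + 1) * (1 + ε))) :
    FiniteSaturation :=
  ⟨k, hk, omegaRect_eq_of_host hr hhost⟩

/-- **Border-certified host ⟹ FiniteSaturation** (the special branch's certificate: ONE finite
identity `R̲(t) ≤ b` plus the far-edge extractions; `R̃(t) ≤ R̲(t)`, BCS Lemma (15.27)).
[cite: BurgisserClausenShokrollahi1997, Lemma (15.27)] -/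
theorem finiteSaturation_of_borderHost [DecidableEq ι] [DecidableEq κ] [DecidableEq μ] {b : ℕ}
    (hk : 2 ≤ k) (hb : algBorderRank t ≤ b)
    (hhost : ∀ ε : ℝ, 0 < ε → ∃ N m : ℕ, 2 ≤ m ∧
      AlgDegeneratesTo (kroneckerPow t (N + 1)) (matMulTensor ℂ m (m ^ k) m) ∧
      (b : ℝ) ^ (N + 1) ≤ (m : ℝ) ^ (((k : ℝ) + 1) * (1 + ε))) :
    FiniteSaturation :=
  finiteSaturation_of_host hk (asymptoticRank_le_of_algBorderRank_le hb) hhost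

/-- **A CLLZ asymptotic `T`-method proving `ω̂(k) ≤ k + 1` gives `FiniteSaturation`** (`k ≥ 2`),
through the tree's proved soundness theorem (middle placement) and the information bound.
[cite: ChristandlLeGallLysikovZuiddam2025, Thm. 2.1 and Rem. 3.13] -/
theorem finiteSaturation_of_tMethodBound {T : ι → κ → μ → ℂ} (hk : 2 ≤ k)
    (h : IsTMethodBound ℂ T (k : ℝ) ((k : ℝ) + 1)) : FiniteSaturation :=
  ⟨k, hk, le_antisymm
    (CLLZ2025_tMethodBound_sound_holds ℂ T (k : ℝ) ((k : ℝ) + 1) (by positivity) h).2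
    (add_one_le_omegaRect_farEdge k)⟩

/-! ## §3 The route-level dichotomy (stated before §2 to share the section variables) -/

/-- **Dichotomy of hosts** (exhaustive): a host of a finite saturation is either *border-flat*,
`R̲(t) = R̃(t) = r` (then of minimal border rank `≤ min(|κ|,|μ|)`, `borderHost_flat`), or *strictly
flat*, `R̃(t) = r < R̲(t)` (certified below border rank only). [cite: AlmanLi2026, Cor. 6.1] -/
theorem host_dichotomy [DecidableEq ι] [DecidableEq κ] [DecidableEq μ] (hr : asymptoticRank t ≤ r)
    (hhost : ∀ ε : ℝ, 0 < ε → ∃ N m : ℕ, 2 ≤ m ∧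
      AlgDegeneratesTo (kroneckerPow t (N + 1)) (matMulTensor ℂ m (m ^ k) m) ∧
      r ^ (N + 1) ≤ (m : ℝ) ^ (((k : ℝ) + 1) * (1 + ε))) :
    asymptoticRank t = r ∧ r ≤ Fintype.card κ ∧ r ≤ Fintype.card μ ∧
      ((algBorderRank t : ℝ) = r ∨ r < algBorderRank t) := by
  have hR := asymptoticRank_eq_of_host hr hhost
  have hc := le_card_of_host hr hhost
  have hle : r ≤ algBorderRank t := hR ▸ asymptoticRank_le_algBorderRank t
  exact ⟨hR, hc.1, hc.2, (eq_or_lt_of_le hle).imp Eq.symm id⟩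

end Host

/-! ## §2 The EQUIV boundary -/

/-- **`⟨2, 2^k, 2⟩` is its own `R̃`-host as soon as `e(k) = 0`** (`N = 0`, `m = 2`, `t^{⊠1} ≥ t`,
cost `R̃(⟨2,2^k,2⟩) = 2^{ω(1,k,1)} = 2^{k+1}`). [folklore] -/
theorem matMulTensor_selfHost_of_saturated {k : ℕ} (hsat : omegaRect ℂ 1 k 1 = (k : ℝ) + 1) :
    ∀ ε : ℝ, 0 < ε → ∃ N m : ℕ, 2 ≤ m ∧
      AlgDegeneratesTo (kroneckerPow (matMulTensor ℂ 2 (2 ^ k) 2) (N + 1))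
        (matMulTensor ℂ m (m ^ k) m) ∧
      asymptoticRank (matMulTensor ℂ 2 (2 ^ k) 2) ^ (N + 1) ≤
        (m : ℝ) ^ (((k : ℝ) + 1) * (1 + ε)) := by
  intro ε hε
  refine ⟨0, 2, le_rfl, (tensorRestrictsTo_kroneckerPow_one _).algDegeneratesTo, ?_⟩
  rw [zero_add, pow_one, ← rpow_omegaRect_eq_asymptoticRank_farEdge le_rfl k, hsat]
  push_cast
  exact Real.rpow_le_rpow_of_exponent_le one_le_two
    (le_mul_of_one_le_right (by positivity) (by linarith))

/-- **EQUIV**: `FiniteSaturation ↔ ∃ k ≥ 2, Host_k(⟨2,2^k,2⟩, R̃(⟨2,2^k,2⟩))` — with the asymptotic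
rank itself as proxy the host statement restates the crux (tag COSTUME); the object has content
only through the certificate of `R̃(t) ≤ r` (§1 border identity / §3 below-border theorem).
[folklore] -/
theorem finiteSaturation_iff_selfHost :
    FiniteSaturation ↔ ∃ k : ℕ, 2 ≤ k ∧ ∀ ε : ℝ, 0 < ε → ∃ N m : ℕ, 2 ≤ m ∧
      AlgDegeneratesTo (kroneckerPow (matMulTensor ℂ 2 (2 ^ k) 2) (N + 1))
        (matMulTensor ℂ m (m ^ k) m) ∧
      asymptoticRank (matMulTensor ℂ 2 (2 ^ k) 2) ^ (N + 1) ≤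
        (m : ℝ) ^ (((k : ℝ) + 1) * (1 + ε)) := by
  constructor
  · rintro ⟨k, hk, hsat⟩
    exact ⟨k, hk, matMulTensor_selfHost_of_saturated hsat⟩
  · rintro ⟨k, hk, hhost⟩
    exact finiteSaturation_of_host hk le_rfl hhost

/-- **Dictionary** (tag EQUIV): `FiniteSaturation ↔ ∃ k ≥ 2, R̃(⟨2, 2^k, 2⟩) = 2^{k+1}`
(`R̃(⟨2,2^k,2⟩) = 2^{ω(1,k,1)}`, ADVXXZ §3.4, and injectivity of `x ↦ 2^x`).
[cite: AlmanDuanVassilevskaWilliamsXuXuZhou2025, §3.4] -/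
theorem finiteSaturation_iff_asymptoticRank_two :
    FiniteSaturation ↔ ∃ k : ℕ, 2 ≤ k ∧
      asymptoticRank (matMulTensor ℂ 2 (2 ^ k) 2) = (2 : ℝ) ^ ((k : ℝ) + 1) := by
  unfold FiniteSaturation
  refine exists_congr fun k => and_congr_right fun _ => ?_
  rw [← rpow_omegaRect_eq_asymptoticRank_farEdge le_rfl k]
  push_cast
  constructor
  · intro h
    rw [h]
  · intro h
    exact le_antisymm ((Real.rpow_le_rpow_left_iff one_lt_two).1 h.le)
      ((Real.rpow_le_rpow_left_iff one_lt_two).1 h.ge)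

/- The generic branch contains the route's aside `LittleCwFlat` and the special branch does not
contain `cw_q`: no border identity on `cw_q` (`q ≥ 2`) certifies a finite saturation
(`FarEdgeDescentHostProfile.cwTensor_not_borderHost`, `R̲(cw_q) = q + 2 > q + 1`), while the
admissible proxy `r = q + 1` (`cwTensor_host_proxy`) is exactly the hypothesis
`R̃(cw_{k+1}) ≤ k + 2` of `LittleCwFlat` (tree: `finiteSaturation_of_littleCwMinimal`). -/

end Summit.MatrixMultiplication.MatrixMultiplication.Theorems.FarEdgeDescentHostBridge
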